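import Literature.MathematicalPhysics.QuantumFieldTheory.Balaban1983to89.B8LeafModelZd3Map
import Literature.MathematicalPhysics.QuantumFieldTheory.Balaban1983to89.B8Prop6CubeMemberOfPrinted

/-!
# `Balaban1983to89.B8LeafKnitZd3CubOfPrinted` — [Balaban1985RegularSpaces] THE RE-TYPED N05 LEAF `B8LeafRS` ON AN INDEX-MAPPED SUB-FAMILY
# OF THE PROTOTYPE `zdGF3`, KNIT FROM PRINTED STATEMENTS ONLY: Theorem 4 (p. 88) and Proposition 3 (p. 87) as hypotheses, PROPOSITION 6
# (p. 99) DISCHARGED at the concrete cube family `Node00.zdCub` by `B8Prop6CubeMemberOfPrinted` — no socket anywhere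

statement-level skeleton of published theorems with citation tags; proofs where landed; nothing here is a claim about the
Yang–Mills mass gap

PDF held: `paper:balaban1985-cmp99-regular-spaces-gauge-fixing` (journal page = PDF page + 74); pp. 79, 83, 87–88, 94, 99–101.

CITATION HEADER (lean-in-tree rule).  Cell `pub-ymgap` (YM Track A, HUMAN RULING D-0062), DAG node N05 = [B8], seat `pub-ymgap-dag-n05-e`
(R141 (C) fan-out; FAN-OUT v1.1 §N05 row s3b), generation g6 — the knit-face twin of `B8Prop6CubeMemberOfPrinted` (pattern of this seat's g2
`B8LeafKnitZd3Cub`, whose `p6` providers were the cube-member sockets, unsatisfiable at finite `Ω₀` by the g5 certificates).  WHY: n05-a's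
socket-free glue `B8LeafKnitZd3E.b8LeafRS_zd3_map_of_thm4` ∕ `B8LeafKnitZd3OfThm4.b8LeafRS_zd3_univ_of_thm4` knits the re-typed leaf from
`H4 : B8.Thm4Printed …` with `p3`∕`t2` fed from the b9 socket `SB9` and `p6 : B8.Prop6Printed …` a free hypothesis; n05-a's
`B8LeafModelZd3Map.thm2Printed_zd3_map_of_thm4` already takes Proposition 3 AS PRINTED (`H3`).  THIS FILE closes the triangle: the leaf on
`fam₃ ∘ ι` (`(ι j).Ω 0 = ℤᵈ`) from `H4`, `H3` on the image of `ι` AND Theorem 4 ∕ Proposition 3 as printed on the CUBE SUB-FAMILY of `ZdIdx d L`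
(for Proposition 6, `B8Prop6CubeMemberOfPrinted.prop6Printed_zdCub_of_printed`), the printed members `p5e p5u p7 t8` — and NOTHING ELSE:
Lemma 1 by name, Theorem 2 derived, Proposition 6 derived.  Kind «kernel-checked proof», theorems only, no `def`.

WHAT THIS FILE PROVES (kernel, 0 sorry).  §1 `prop3Printed_of_C₂_le` — `B8.Prop3Printed` is monotone in the (1.61)-constant `C₂` (a larger
`C₂` only strengthens the hypothesis (1.61); pure bookkeeping).  §2 **`b8LeafRS_zd3_map_of_printed`** — ONE threshold `c₁ > 0` (from the cube
sub-family's two printed thresholds; chosen before `ι` and `f`) such that for every index map `ι : J → ZdIdx d L` with `(ι j).Ω 0 = univ`, every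
cube-family index `f : J′ → ZdIdx d L` and every `toAxial`: `H4 : B8.Thm4Printed (5dL·inp.B₀) (fam₃ ∘ ι)`, `H3 : B8.Prop3Printed d L
(2097152(d+1)²) inp B₀β (fam₂ ∘ ι)`, `p5e p5u p7 t8` ⟹ `B8LeafRS d L C₂ (5dL·inp.B₀) inp.B₀′ (5dL·inp.B₀) B₂ c₁ inp B₀β (blockPairNA d Lb 𝔸)
(fam₃ ∘ ι) lan (zdCub 𝔸 L ∘ f) toAxial` (`C₂ ≥ 2097152(d+1)²`; `l1 := lemma1Printed_blockPairNA`, `t2 := thm2Printed_zd3_map_of_thm4 H4 H3`,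
`p3 := H3` lifted to `C₂`, `t4 := H4`, `p6 := prop6Printed_zdCub_of_printed H4c H3c f`).  §3 **`b8LeafRS_zd3_univ_of_printed`** — the statement
of record (`ι := Subtype.val` on `{i // i.Ω 0 = univ}`).  §4 **`b8LeafRS_zd3_univ_of_printedAll`** — the same from ONE `H4` and ONE `H3` over the
WHOLE index `ZdIdx d L` (the binders of `b8LeafRS_zd3_univ_of_thm4` with `SB9 ↦ H3`): there `p6` needs no extra hypothesis at all.

HONEST SCOPE.  (i) Bookkeeping BY NAME; nothing of Lemma 1 – Theorem 8 is proved beyond the landed assemblies.  (ii) Hypotheses = PRINTED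
STATEMENTS only: Theorem 4 and Proposition 3 at the `Ω₀ = ℤᵈ` members (image of `ι`) and at print's cube families `{□_j}_{j=0}^{k}` (the cube
sub-family, `CubeB8` regime), Proposition 5 (∃ ∕ !), Proposition 7 (faithful), Theorem 8 (surviving); their discharge is NOT claimed (at the
cube families it is exactly the located socket question of this seat's g5, `CORNER-DEFECT-H59.md`).  (iii) §4's whole-index binders are as
satisfiable as the whole index allows (ref-A J2′: `ZdIdx d L` has degenerate members) — recorded, not used by §2–§3.  (iv) `B₁ := 5dL·inp.B₀`
for `p5e`∕`p6`∕`t8` (Proposition 6's printed constant, p. 99; `Node00.prop6Printed_zdCub_mono` raises it).  Count-neutral; N05 NOT discharged;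
one finite `𝕋⁴` programme at fixed `ε`, Bałaban as printed; nothing continuum ∕ ℝ⁴ ∕ OS ∕ mass-gap ∕ Clay.  Unit `pub-ymgap-dag-n05-e` (g6),
2026-08-27.
-/

noncomputable section

open NormedSpace

namespace Literature.MathematicalPhysics.QuantumFieldTheory.Balaban1983to89.B8LeafKnitZd3CubOfPrinted

open B7Prop1Explicit
open B8Lemma1NonAbelian (blockPairNA lemma1Printed_blockPairNA)
open B8LeafKnitRS (B8LeafRS)
open B8LeafModelZd (ZdIdx)
open B8LeafModelZd3 (zdGF3)
open B8LeafModelZd3Map (thm2Printed_zd3_map_of_thm4)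
open B8Eq131CubesAdmissible (cubeFam)
open B8CubeMemberZd (cubeLamS cubeLamB)
open B8Prop6CubeMemberOfPrinted (prop6Printed_zdCub_of_printed)
open Node00 (CubeB8 zdCub)

-- `Site` alone could resolve to the torus sites of `Setup.lean`; re-export the `ℤ^d` sites of `B7Prop1Explicit`.
export B7Prop1Explicit (Site)

variable {d : ℕ}

/-! ## §1 Proposition 3 is monotone in the (1.61)-constant `C₂` -/

/-- **`B8.Prop3Printed` is monotone in `C₂`**: the (1.61)-window «2α₂² + 20dα₀α₂ + 2C₂α₂² ≦ α₀ + α₁» with a larger `C₂` implies it with a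
smaller one, so Proposition 3 stated with `C₂` gives Proposition 3 stated with every `C₂′ ≥ C₂` (same threshold). Pure bookkeeping.
[cite: Balaban1985RegularSpaces, (1.61) p.86, Prop. 3 p.87] -/
theorem prop3Printed_of_C₂_le {I : Type} {n : ℕ} {L C₂ C₂' : ℝ} {inp : B8.B9Inputs} {B₀β : ℝ} {fam : I → B8.GFData2} (h : C₂ ≤ C₂')
    (H : B8.Prop3Printed n L C₂ inp B₀β fam) : B8.Prop3Printed n L C₂' inp B₀β fam := by
  obtain ⟨c, hc, H⟩ := H
  refine ⟨c, hc, fun i α₀ α₁ α₂ hα₀ hα₀c hα₁ hα₁c hα₂ hα₂c h61 U₀ U₁ hInA hReg hPair h162 hLan h137 => ?_⟩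
  have hmono : 2 * C₂ * α₂ ^ 2 ≤ 2 * C₂' * α₂ ^ 2 :=
    mul_le_mul_of_nonneg_right (mul_le_mul_of_nonneg_left h (by norm_num)) (sq_nonneg _)
  exact H i α₀ α₁ α₂ hα₀ hα₀c hα₁ hα₁c hα₂ hα₂c (by linarith) U₀ U₁ hInA hReg hPair h162 hLan h137

/-! ## §2 The re-typed leaf on `fam₃ ∘ ι` from printed statements only, Proposition 6 discharged at the cube family -/

section Knit

variable {𝔸 : Type} [CStarAlgebra 𝔸] [Nontrivial 𝔸]
variable {I₃ : Type} {lan : I₃ → B8.LandauData}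

/-- **THE RE-TYPED B8 LEAF ON AN INDEX-MAPPED SUB-FAMILY, KNIT FROM PRINTED STATEMENTS ONLY, PROPOSITION 6 DISCHARGED AT THE CONCRETE CUBE
FAMILY** (generic over `ι : J → ZdIdx d L` with `(ι j).Ω 0 = univ` and a cube-family index `f : J′ → ZdIdx d L`): ONE threshold `c₁ > 0`
(before `ι`, `f`); hypotheses `H4 : B8.Thm4Printed (5dL·inp.B₀) (fam₃ ∘ ι)`, `H3 : B8.Prop3Printed d L (2097152(d+1)²) inp B₀β (fam₂ ∘ ι)`, the
same two printed sentences on the cube sub-family of `ZdIdx d L` (`H4c`, `H3c`), and the printed members `p5e p5u p7 t8`; `l1 :=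
lemma1Printed_blockPairNA`, `t2 := thm2Printed_zd3_map_of_thm4 H4 H3` (n05-a), `p3 := H3` lifted to `C₂`, `t4 := H4`,
`p6 := prop6Printed_zdCub_of_printed H4c H3c f` (this seat, g6).  No socket.
[cite: Balaban1985RegularSpaces, Lemma 1 p.79, Thm 2 p.83, Prop. 3 p.87, Thm 4 p.88, Prop. 6 p.99 (derived); Prop. 5 p.94, Prop. 7 p.100, Thm 8 p.101 (named hypotheses)] -/
theorem b8LeafRS_zd3_map_of_printed (hd2 : 2 ≤ d) {L : ℕ} (hL : 2 ≤ L) (Lb : ℕ) (β : ℝ) (len : Site d → ℝ) (inp : B8.B9Inputs)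
    {B₀β C₂ B₀βc C₂c B₂ : ℝ} (hB : 2 ≤ 5 * (d : ℝ) * L * inp.B₀) (hB₀β : 0 < B₀β)
    (hC₂ : 2097152 * ((d : ℝ) + 1) ^ 2 ≤ C₂) (hC₂c : 0 ≤ C₂c)
    (H4c : B8.Thm4Printed (5 * (d : ℝ) * L * inp.B₀)
      (fun i : {i : ZdIdx d L // ∃ (a : Site d) (M ρ : ℕ), L ≤ ρ ∧ ρ ≤ M ∧ 11 * d < M ∧ L ≤ d * M ∧
        i.Ω = cubeFam false L a M ρ i.k ∧ i.Λs = cubeLamS L a M ρ i.k ∧ i.Λb = cubeLamB L a M ρ i.k} => (zdGF3 𝔸 L β len i.1).toGFData))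
    (H3c : B8.Prop3Printed d (L : ℝ) C₂c inp B₀βc
      (fun i : {i : ZdIdx d L // ∃ (a : Site d) (M ρ : ℕ), L ≤ ρ ∧ ρ ≤ M ∧ 11 * d < M ∧ L ≤ d * M ∧
        i.Ω = cubeFam false L a M ρ i.k ∧ i.Λs = cubeLamS L a M ρ i.k ∧ i.Λb = cubeLamB L a M ρ i.k} => (zdGF3 𝔸 L β len i.1).toGFData2)) :
    ∃ c₁ : ℝ, 0 < c₁ ∧ ∀ {J : Type} (ι : J → ZdIdx d L), (∀ j, (ι j).Ω 0 = Set.univ) →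
      B8.Thm4Printed (5 * (d : ℝ) * L * inp.B₀) (fun j : J => (zdGF3 𝔸 L β len (ι j)).toGFData) →
      B8.Prop3Printed d (L : ℝ) (2097152 * ((d : ℝ) + 1) ^ 2) inp B₀β (fun j : J => (zdGF3 𝔸 L β len (ι j)).toGFData2) →
      ∀ {J' : Type} (f : J' → ZdIdx d L)
      {toAxial : ∀ j : J, (zdGF3 𝔸 L β len (ι j)).Cfg → (zdGF3 𝔸 L β len (ι j)).Pert → (zdGF3 𝔸 L β len (ι j)).Pert},
      B8.Prop5Exists inp.B₀' (5 * (d : ℝ) * L * inp.B₀) lan → B8.Prop5Unique lan →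
      B8SectGH.Prop7PrintedR (fun j : J => zdGF3 𝔸 L β len (ι j)) toAxial →
      B8Thm8Surviving.Thm8SurvivingAt 1 (5 * (d : ℝ) * L * inp.B₀) B₂ (fun j : J => zdGF3 𝔸 L β len (ι j)) →
      B8LeafRS d (L : ℝ) C₂ (5 * (d : ℝ) * L * inp.B₀) inp.B₀' (5 * (d : ℝ) * L * inp.B₀) B₂ c₁ inp B₀β (blockPairNA d Lb 𝔸)
        (fun j : J => zdGF3 𝔸 L β len (ι j)) lan (fun j : J' => zdCub 𝔸 L (f j)) toAxial := by
  obtain ⟨c₁, hc₁, P6⟩ := prop6Printed_zdCub_of_printed (𝔸 := 𝔸) hd2 hL inp hC₂c β len H4c H3c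
  refine ⟨c₁, hc₁, fun ι hΩ H4 H3 _ f _ p5e p5u p7 t8 => ?_⟩
  exact
    { l1 := lemma1Printed_blockPairNA d Lb 𝔸
      t2 := thm2Printed_zd3_map_of_thm4 hd2 hL inp.B₀_pos inp.B₀'_pos hB₀β hB ι hΩ H4 H3
      p3 := prop3Printed_of_C₂_le hC₂ H3
      t4 := H4
      p5e := p5e
      p5u := p5u
      p6 := P6 f
      p7 := p7
      t8 := t8 }

/-! ## §3 The statement of record: the `Ω₀ = ℤᵈ` sub-family (`ι := Subtype.val`) -/

/-- **THE RE-TYPED B8 LEAF AT THE PROTOTYPE (`Ω₀ = ℤᵈ` sub-family), KNIT FROM PRINTED STATEMENTS ONLY, PROPOSITION 6 DISCHARGED AT THE CUBE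
FAMILY** — `b8LeafRS_zd3_map_of_printed` at `ι := Subtype.val`.  Hypotheses: Theorem 4 and Proposition 3 as printed on the `Ω₀ = ℤᵈ`
sub-family and on the cube sub-family; Proposition 5 (∃ ∕ !), Proposition 7, Theorem 8 (surviving).  No socket, no `p6`.
[cite: Balaban1985RegularSpaces, Lemma 1 p.79, Thm 2 p.83, Prop. 3 p.87, Thm 4 p.88, Prop. 6 p.99 (derived); Prop. 5 p.94, Prop. 7 p.100, Thm 8 p.101 (named hypotheses)] -/
theorem b8LeafRS_zd3_univ_of_printed (hd2 : 2 ≤ d) {L : ℕ} (hL : 2 ≤ L) (Lb : ℕ) (β : ℝ) (len : Site d → ℝ) (inp : B8.B9Inputs)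
    {B₀β C₂ B₀βc C₂c B₂ : ℝ} (hB : 2 ≤ 5 * (d : ℝ) * L * inp.B₀) (hB₀β : 0 < B₀β)
    (hC₂ : 2097152 * ((d : ℝ) + 1) ^ 2 ≤ C₂) (hC₂c : 0 ≤ C₂c)
    (H4c : B8.Thm4Printed (5 * (d : ℝ) * L * inp.B₀)
      (fun i : {i : ZdIdx d L // ∃ (a : Site d) (M ρ : ℕ), L ≤ ρ ∧ ρ ≤ M ∧ 11 * d < M ∧ L ≤ d * M ∧
        i.Ω = cubeFam false L a M ρ i.k ∧ i.Λs = cubeLamS L a M ρ i.k ∧ i.Λb = cubeLamB L a M ρ i.k} => (zdGF3 𝔸 L β len i.1).toGFData))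
    (H3c : B8.Prop3Printed d (L : ℝ) C₂c inp B₀βc
      (fun i : {i : ZdIdx d L // ∃ (a : Site d) (M ρ : ℕ), L ≤ ρ ∧ ρ ≤ M ∧ 11 * d < M ∧ L ≤ d * M ∧
        i.Ω = cubeFam false L a M ρ i.k ∧ i.Λs = cubeLamS L a M ρ i.k ∧ i.Λb = cubeLamB L a M ρ i.k} => (zdGF3 𝔸 L β len i.1).toGFData2)) :
    ∃ c₁ : ℝ, 0 < c₁ ∧
      (B8.Thm4Printed (5 * (d : ℝ) * L * inp.B₀) (fun i : {i : ZdIdx d L // i.Ω 0 = Set.univ} => (zdGF3 𝔸 L β len i.1).toGFData) →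
      B8.Prop3Printed d (L : ℝ) (2097152 * ((d : ℝ) + 1) ^ 2) inp B₀β
        (fun i : {i : ZdIdx d L // i.Ω 0 = Set.univ} => (zdGF3 𝔸 L β len i.1).toGFData2) →
      ∀ {J' : Type} (f : J' → ZdIdx d L)
      {toAxial : ∀ i : {i : ZdIdx d L // i.Ω 0 = Set.univ}, (zdGF3 𝔸 L β len i.1).Cfg → (zdGF3 𝔸 L β len i.1).Pert →
        (zdGF3 𝔸 L β len i.1).Pert},
      B8.Prop5Exists inp.B₀' (5 * (d : ℝ) * L * inp.B₀) lan → B8.Prop5Unique lan →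
      B8SectGH.Prop7PrintedR (fun i : {i : ZdIdx d L // i.Ω 0 = Set.univ} => zdGF3 𝔸 L β len i.1) toAxial →
      B8Thm8Surviving.Thm8SurvivingAt 1 (5 * (d : ℝ) * L * inp.B₀) B₂ (fun i : {i : ZdIdx d L // i.Ω 0 = Set.univ} => zdGF3 𝔸 L β len i.1) →
      B8LeafRS d (L : ℝ) C₂ (5 * (d : ℝ) * L * inp.B₀) inp.B₀' (5 * (d : ℝ) * L * inp.B₀) B₂ c₁ inp B₀β (blockPairNA d Lb 𝔸)
        (fun i : {i : ZdIdx d L // i.Ω 0 = Set.univ} => zdGF3 𝔸 L β len i.1) lan (fun j : J' => zdCub 𝔸 L (f j)) toAxial) := by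
  obtain ⟨c₁, hc₁, K⟩ := b8LeafRS_zd3_map_of_printed (𝔸 := 𝔸) (lan := lan) hd2 hL Lb β len inp (B₂ := B₂) hB hB₀β hC₂ hC₂c H4c H3c
  exact ⟨c₁, hc₁, fun H4 H3 _ f _ p5e p5u p7 t8 =>
    K (Subtype.val : {i : ZdIdx d L // i.Ω 0 = Set.univ} → ZdIdx d L) (fun i => i.2) H4 H3 f p5e p5u p7 t8⟩

/-! ## §4 The same from ONE `H4` and ONE `H3` over the whole index `ZdIdx d L` -/

/-- **THE RE-TYPED B8 LEAF AT THE PROTOTYPE FROM THEOREM 4 AND PROPOSITION 3 AS PRINTED OVER THE WHOLE INDEX `ZdIdx d L`** — the binders of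
n05-a's `B8LeafKnitZd3OfThm4.b8LeafRS_zd3_univ_of_thm4` with the b9 socket `SB9` replaced by the printed `H3` and the `p6` binder DERIVED
(`b8LeafRS_zd3_univ_of_printed` with every family-indexed hypothesis obtained by restriction of the index).  Recorded for that currency; the
sub-family form §3 is the sharp one (§4's binders quantify over every member of `ZdIdx d L`).
[cite: Balaban1985RegularSpaces, Lemma 1 p.79, Thm 2 p.83, Prop. 3 p.87, Thm 4 p.88, Prop. 6 p.99 (derived); Prop. 5 p.94, Prop. 7 p.100, Thm 8 p.101 (named hypotheses)] -/
theorem b8LeafRS_zd3_univ_of_printedAll (hd2 : 2 ≤ d) {L : ℕ} (hL : 2 ≤ L) (Lb : ℕ) (β : ℝ) (len : Site d → ℝ) (inp : B8.B9Inputs)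
    {B₀β C₂ B₂ : ℝ} (hB : 2 ≤ 5 * (d : ℝ) * L * inp.B₀) (hB₀β : 0 < B₀β) (hC₂ : 2097152 * ((d : ℝ) + 1) ^ 2 ≤ C₂)
    (H4 : B8.Thm4Printed (5 * (d : ℝ) * L * inp.B₀) (fun i : ZdIdx d L => (zdGF3 𝔸 L β len i).toGFData))
    (H3 : B8.Prop3Printed d (L : ℝ) (2097152 * ((d : ℝ) + 1) ^ 2) inp B₀β (fun i : ZdIdx d L => (zdGF3 𝔸 L β len i).toGFData2)) :
    ∃ c₁ : ℝ, 0 < c₁ ∧ ∀ {J' : Type} (f : J' → ZdIdx d L)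
      {toAxial : ∀ i : {i : ZdIdx d L // i.Ω 0 = Set.univ}, (zdGF3 𝔸 L β len i.1).Cfg → (zdGF3 𝔸 L β len i.1).Pert →
        (zdGF3 𝔸 L β len i.1).Pert},
      B8.Prop5Exists inp.B₀' (5 * (d : ℝ) * L * inp.B₀) lan → B8.Prop5Unique lan →
      B8SectGH.Prop7PrintedR (fun i : {i : ZdIdx d L // i.Ω 0 = Set.univ} => zdGF3 𝔸 L β len i.1) toAxial →
      B8Thm8Surviving.Thm8SurvivingAt 1 (5 * (d : ℝ) * L * inp.B₀) B₂ (fun i : {i : ZdIdx d L // i.Ω 0 = Set.univ} => zdGF3 𝔸 L β len i.1) →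
      B8LeafRS d (L : ℝ) C₂ (5 * (d : ℝ) * L * inp.B₀) inp.B₀' (5 * (d : ℝ) * L * inp.B₀) B₂ c₁ inp B₀β (blockPairNA d Lb 𝔸)
        (fun i : {i : ZdIdx d L // i.Ω 0 = Set.univ} => zdGF3 𝔸 L β len i.1) lan (fun j : J' => zdCub 𝔸 L (f j)) toAxial := by
  have hC₂0 : (0 : ℝ) ≤ 2097152 * ((d : ℝ) + 1) ^ 2 := by positivity
  obtain ⟨c₄, hc₄, T4⟩ := H4
  obtain ⟨c₃, hc₃, P3⟩ := H3
  obtain ⟨c₁, hc₁, K⟩ := b8LeafRS_zd3_univ_of_printed (𝔸 := 𝔸) (lan := lan) hd2 hL Lb β len inp (B₂ := B₂) hB hB₀β hC₂ hC₂0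
    ⟨c₄, hc₄, fun i => T4 i.1⟩ ⟨c₃, hc₃, fun i => P3 i.1⟩
  exact ⟨c₁, hc₁, fun f _ p5e p5u p7 t8 => K ⟨c₄, hc₄, fun i => T4 i.1⟩ ⟨c₃, hc₃, fun i => P3 i.1⟩ f p5e p5u p7 t8⟩

#print axioms b8LeafRS_zd3_map_of_printed
#print axioms b8LeafRS_zd3_univ_of_printed
#print axioms b8LeafRS_zd3_univ_of_printedAll

end Knit

end Literature.MathematicalPhysics.QuantumFieldTheory.Balaban1983to89.B8LeafKnitZd3CubOfPrinted

end
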